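import Summits.Ventures.HodgeRepro2.T5SU11ResolventSupNormWeighted
import Summits.Ventures.HodgeRepro2.T5SU11SphericalAsymptotic

/-!
# The weighted space `W_{λ′} = {g continuous on (0, ∞) : |g| ≤ D φ_{λ′}}` lies in the class, and the resolvent acts on it

For `1 < λ′ ≤ 2` the spherical weight satisfies `φ_{λ′} ≤ 1` (row 4xx, `sph_hyp_le_one`) and `φ_{λ′}(t) ≤ K e^{(λ′ − 2)t}` for
large `t` (the Harish-Chandra limit `e^{(2 − λ′)t} φ_{λ′}(t) → c(2 − λ′)`, `tendsto_exp_two_sub_mul_sph_hyp`). Hence every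
continuous `g` with `|g| ≤ D φ_{λ′}` on `(0, ∞)` is a source of the class at the rate `2 − λ′ > 2 − λ` for every `λ > λ′`,
and row 550's weighted sup-norm theory applies to it with NO further hypothesis:

* `exists_sph_hyp_le_exp` — `φ_{λ′}(t) ≤ K e^{−(2 − λ′)t}` for `t ≥ T` (`λ′ > 1`);
* `class_of_le_mul_sph` — **`W_{λ′} ⊂ class`**: `|g| ≤ D` on `(0, 1]` and `|g(s)| ≤ D K e^{−(2 − λ′)s}` for `s ≥ T`;
* `abs_greenSolI_le_mul_sph'`, `greenSolI_mem_weighted` — **`G^I_λ` maps `W_{λ′}` into itself with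
  `|G^I_λ g| ≤ D φ_{λ′}/(μ − μ′)`** (`λ > λ′`);
* `abs_iterate_le_mul_sph'`, `abs_greenSolI_sub_le_mul_sph'`, `tendsto_neumann_weighted'` — the iterates, the Lipschitz
  bound in `μ` and the uniformly convergent Neumann series on `|μ − μ₂| < μ₂ − μ′`, for `g ∈ W_{λ′}` alone.

Nothing is claimed about (N).

Blind lane: Mathlib + the HodgeRepro2 prefix only; no sorry; axioms ⊆ {propext, Classical.choice,
Quot.sound}.
-/

namespace Summit.Ventures.HodgeRepro2.T5SU11WeightedSpaceClass

open Filter Topology MeasureTheory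
open Set (Ioi Ioc)
open T5SU11Cartan T5SU11SphericalFunction T5SU11SphericalDecay T5SU11RadialGreenImproper
  T5SU11RadialGreenImproperStable T5SU11SphericalBounds T5SU11SphericalAsymptotic T5SU11ResolventSupNormWeighted

section measure

variable [MeasurableSpace Circle] [BorelSpace Circle]

/-- **The spherical function decays at the rate `2 − λ`** (`λ > 1`): `φ_λ(t) ≤ K e^{−(2 − λ)t}` for `t ≥ T`, from the
Harish-Chandra limit `e^{(2 − λ)t} φ_λ(t) → c(2 − λ)`. -/
theorem exists_sph_hyp_le_exp {lam : ℝ} (hlam : 1 < lam) :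
    ∃ K T : ℝ, 0 ≤ K ∧ 0 < T ∧ ∀ t, T ≤ t → sph lam (hyp t) ≤ K * Real.exp (-(2 - lam) * t) := by
  have h := (tendsto_exp_two_sub_mul_sph_hyp hlam).eventually (eventually_lt_nhds (lt_add_one (cfun (2 - lam))))
  obtain ⟨T₀, hT₀⟩ := eventually_atTop.mp h
  refine ⟨cfun (2 - lam) + 1, max T₀ 1, ?_, by positivity, fun t ht => ?_⟩
  · have := hT₀ (max T₀ 1) (le_max_left _ _)
    have hpos : 0 < Real.exp ((2 - lam) * max T₀ 1) * sph lam (hyp (max T₀ 1)) :=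
      mul_pos (Real.exp_pos _) (sph_hyp_pos _ _)
    linarith
  · have hlt := hT₀ t (le_trans (le_max_left _ _) ht)
    have hexp : 0 < Real.exp ((2 - lam) * t) := Real.exp_pos _
    have e : sph lam (hyp t) = Real.exp (-(2 - lam) * t) * (Real.exp ((2 - lam) * t) * sph lam (hyp t)) := by
      rw [← mul_assoc, ← Real.exp_add]
      have h0 : -(2 - lam) * t + (2 - lam) * t = 0 := by ring
      rw [h0, Real.exp_zero, one_mul]
    rw [e, mul_comm (cfun (2 - lam) + 1)]
    exact mul_le_mul_of_nonneg_left hlt.le (Real.exp_pos _).le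

/-- **The weighted space lies in the class**: for `1 < λ′ ≤ 2` and `|g| ≤ D φ_{λ′}` on `(0, ∞)`, `g` is bounded by `D`
on `(0, 1]`, `D ≥ 0`, and `|g(s)| ≤ D K e^{−(2 − λ′)s}` for `s ≥ T`. -/
theorem class_of_le_mul_sph {lam' : ℝ} (h1 : 1 < lam') (h2' : lam' ≤ 2) {g : ℝ → ℝ} {D : ℝ}
    (hD : ∀ s, 0 < s → |g s| ≤ D * sph lam' (hyp s)) :
    (∀ s ∈ Ioc (0 : ℝ) 1, |g s| ≤ D) ∧ 0 ≤ D ∧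
      ∃ K T : ℝ, 0 ≤ K ∧ 0 < T ∧ ∀ s, T ≤ s → |g s| ≤ (D * K) * Real.exp (-(2 - lam') * s) := by
  have hD0 : 0 ≤ D := by
    have h := hD 1 one_pos
    have hφ : 0 < sph lam' (hyp 1) := sph_hyp_pos lam' 1
    by_contra hneg
    have : D * sph lam' (hyp 1) < 0 := mul_neg_of_neg_of_pos (not_le.mp hneg) hφ
    linarith [abs_nonneg (g 1)]
  obtain ⟨K, T, hK0, hT, hKT⟩ := exists_sph_hyp_le_exp h1
  refine ⟨fun s hs => ?_, hD0, K, T, hK0, hT, fun s hs => ?_⟩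
  · calc |g s| ≤ D * sph lam' (hyp s) := hD s hs.1
      _ ≤ D * 1 := mul_le_mul_of_nonneg_left (sph_hyp_le_one (by linarith) h2' s) hD0
      _ = D := mul_one D
  · calc |g s| ≤ D * sph lam' (hyp s) := hD s (by linarith)
      _ ≤ D * (K * Real.exp (-(2 - lam') * s)) := mul_le_mul_of_nonneg_left (hKT s hs) hD0
      _ = (D * K) * Real.exp (-(2 - lam') * s) := by ring

variable {lam lam' : ℝ} (hlam : 1 < lam) (h1 : 1 < lam') (h2 : lam' < lam) (h2' : lam' ≤ 2)
  {g : ℝ → ℝ} (hg : ContinuousOn g (Ioi 0)) {D : ℝ} (hD : ∀ s, 0 < s → |g s| ≤ D * sph lam' (hyp s))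

include hlam h1 h2 h2' hg hD in
/-- **The weighted `L^∞` bound on `W_{λ′}`**: `|G^I_λ g(t)| ≤ D φ_{λ′}(t)/(μ − μ′)` for every `t > 0` (`1 < λ′ ≤ 2`,
`λ > λ′`, `g` continuous with `|g| ≤ D φ_{λ′}` — no other hypothesis). -/
theorem abs_greenSolI_le_mul_sph' {t : ℝ} (ht : 0 < t) :
    |greenSolI (fun t => sph lam (hyp t)) (sphDecay lam) g t|
      ≤ D * sph lam' (hyp t) / (lam * (lam - 2) - lam' * (lam' - 2)) := by
  obtain ⟨hM, hD0, K, T, hK0, hT, hKT⟩ := class_of_le_mul_sph h1 h2' hD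
  exact abs_greenSolI_le_mul_sph hlam h1 h2 hg hM hD0 (by linarith : 2 - lam < 2 - lam') hKT hD ht

include hlam h1 h2 h2' hg hD in
/-- **`G^I_λ` maps `W_{λ′}` into itself**: `G^I_λ g` is continuous on `(0, ∞)` with `|G^I_λ g| ≤ (D/(μ − μ′)) φ_{λ′}`. -/
theorem greenSolI_mem_weighted :
    ContinuousOn (greenSolI (fun t => sph lam (hyp t)) (sphDecay lam) g) (Ioi 0) ∧
      ∀ s, 0 < s → |greenSolI (fun t => sph lam (hyp t)) (sphDecay lam) g s|
        ≤ (D / (lam * (lam - 2) - lam' * (lam' - 2))) * sph lam' (hyp s) := by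
  obtain ⟨hM, hD0, K, T, hK0, hT, hKT⟩ := class_of_le_mul_sph h1 h2' hD
  refine ⟨continuousOn_greenSolI hlam hg hM hD0 (by linarith : 2 - lam < 2 - lam') hKT, fun s hs => ?_⟩
  rw [div_mul_eq_mul_div]
  exact abs_greenSolI_le_mul_sph' hlam h1 h2 h2' hg hD hs

include hlam h1 h2 h2' hg hD in
/-- **The iterates on `W_{λ′}`**: `|(G^I_λ)ⁿ g(t)| ≤ D φ_{λ′}(t)/(μ − μ′)ⁿ`. -/
theorem abs_iterate_le_mul_sph' (n : ℕ) :
    ∀ t, 0 < t → |((greenSolI (fun t => sph lam (hyp t)) (sphDecay lam))^[n] g) t|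
      ≤ D * sph lam' (hyp t) / (lam * (lam - 2) - lam' * (lam' - 2)) ^ n := by
  obtain ⟨hM, hD0, K, T, hK0, hT, hKT⟩ := class_of_le_mul_sph h1 h2' hD
  exact abs_iterate_le_mul_sph hlam h1 h2 hg hM hD0 (by linarith : 2 - lam < 2 - lam') hKT hD n

include h1 h2 h2' hg hD in
/-- **The resolvent is Lipschitz in `μ` on `W_{λ′}`**: `|G^I_λ g(t) − G^I_{λ₂} g(t)| ≤ |μ − μ₂| D φ_{λ′}(t)/((μ − μ′)(μ₂ − μ′))`
for `λ, λ₂ > λ′`. -/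
theorem abs_greenSolI_sub_le_mul_sph' {lam₂ : ℝ} (h2₂ : lam' < lam₂) {t : ℝ} (ht : 0 < t) :
    |greenSolI (fun t => sph lam (hyp t)) (sphDecay lam) g t - greenSolI (fun t => sph lam₂ (hyp t)) (sphDecay lam₂) g t|
      ≤ |lam * (lam - 2) - lam₂ * (lam₂ - 2)| * D * sph lam' (hyp t)
        / ((lam * (lam - 2) - lam' * (lam' - 2)) * (lam₂ * (lam₂ - 2) - lam' * (lam' - 2))) := by
  obtain ⟨hM, hD0, K, T, hK0, hT, hKT⟩ := class_of_le_mul_sph h1 h2' hD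
  exact abs_greenSolI_sub_le_mul_sph h1 h2 h2₂ hg hM hD0 (by linarith : 2 - lam < 2 - lam')
    (by linarith : 2 - lam₂ < 2 - lam') hKT hD ht

include h1 h2 h2' hg hD in
/-- **The Neumann series converges in the weighted sup-norm on `W_{λ′}` for `|μ − μ₂| < μ₂ − μ′`** (`λ, λ₂ > λ′`). -/
theorem tendsto_neumann_weighted' {lam₂ : ℝ} (h2₂ : lam' < lam₂)
    (hq : |lam * (lam - 2) - lam₂ * (lam₂ - 2)| < lam₂ * (lam₂ - 2) - lam' * (lam' - 2)) :
    Tendsto (fun n : ℕ => (|lam * (lam - 2) - lam₂ * (lam₂ - 2)| / (lam₂ * (lam₂ - 2) - lam' * (lam' - 2))) ^ (n + 1)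
      * (D / (lam * (lam - 2) - lam' * (lam' - 2)))) atTop (𝓝 0) ∧
    ∀ n : ℕ, ∀ t, 0 < t → |greenSolI (fun t => sph lam (hyp t)) (sphDecay lam) g t
        - ∑ k ∈ Finset.range (n + 1), (lam * (lam - 2) - lam₂ * (lam₂ - 2)) ^ k
          * (greenSolI (fun t => sph lam₂ (hyp t)) (sphDecay lam₂))^[k + 1] g t|
      ≤ ((|lam * (lam - 2) - lam₂ * (lam₂ - 2)| / (lam₂ * (lam₂ - 2) - lam' * (lam' - 2))) ^ (n + 1)
        * (D / (lam * (lam - 2) - lam' * (lam' - 2)))) * sph lam' (hyp t) := by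
  obtain ⟨hM, hD0, K, T, hK0, hT, hKT⟩ := class_of_le_mul_sph h1 h2' hD
  exact tendsto_neumann_weighted h1 h2 h2₂ hg hM hD0 (by linarith : 2 - lam < 2 - lam')
    (by linarith : 2 - lam₂ < 2 - lam') hKT hD hq

end measure

end Summit.Ventures.HodgeRepro2.T5SU11WeightedSpaceClass
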